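import Mathlib

/-!
# Solo-blind kernel #241 — the far-zone constant-coefficient model in closed form

Regime (II) of the anomalous-dissipation programme reduces the inner dispersion relation to the scalar
function `𝒱 = D_s · D_r − κ · Ŝ` built from the recessive solutions of the streak recurrence
`u (m+1) − (2 + c_m) u m + u (m−1) = 0` and of the roll recurrence
`v (n+1) − (2 + c_n) (1 + 1/(n²−1)) v n + v (n−1) = 0`, `c_m = g² κ − i g⁴ m²`.
In the FAR ZONE (`|x| ≫ 1`, bottom layer) the coefficient is constant, `2 + c = λ + λ⁻¹`.  Then, exactly:

* the streak recessive solution is `u m = λ^m`;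
* with `w n := n · v n` the roll recurrence becomes the Gegenbauer-`(2)` recurrence
  `(n−1) w (n+1) − (λ+λ⁻¹) n w n + (n+1) w (n−1) = 0`, whose recessive solution is
  `w n = λ^n (n + b₀)`, `b₀ = (1+λ²)/(1−λ²)` (`roll_weighted_solution`);
* `D_r = (3i/8) v₁/v₂ = (3i/2) / (λ (3 − λ²))` (`Dr_closed_form`), `D_s = −i (λ²−1)/(2 g λ)` (`Ds_closed_form`);
* with the geometric sums `S₀ = Σ_{m≥2} q^m = q²/(1−q)`, `S₁ = Σ_{m≥2} m q^m = q²(2−q)/(1−q)²` (`q = λ²`,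
  `hasSum_S0`, `hasSum_S1`) the pairing sum is `Ŝ = g (S₁ + b₀ S₀)/(q (2 + b₀))` and
  `𝒱 = D_s D_r − κ Ŝ = D_s D_r · (1 + 4 λ³/(1+λ)²)` (`dispersion_closed_form`);
* on the physical arc `λ = e^{iθ}`, `0 ≤ cos θ` (`−1/sc ≤ x < 0`) the factor has
  `|1 + 4λ³/(1+λ)²|² = 1 + 2 cos 2θ / C + 1/C²`, `C = cos²(θ/2) = (1 + cos θ)/2`, and the polynomial
  inequality `far_zone_margin_poly` gives `|…|² ≥ 2/3` there (the true minimum is `0.7014` at `θ ≈ 0.445 π`);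
  for `x > 0` (`λ ∈ (0,1)`) the factor exceeds `1`.

So the far-zone dispersion function is zero-free with an explicit margin, uniformly in the lattice
parameter `g` (the closed forms hold for every `g`).  Only finite algebra and one polynomial inequality are
certified here; the perturbation bounds that attach the model to the true recurrences are paper-side
([O1]/[O2] of the solo-blind plan, §119).
-/

namespace Summit.AnomalousDissipation.SoloBlind.FarZone

open Complex

/-- The streak recessive solution of the constant-coefficient model: `u m = λ^m` solves
`u (m+2) − (λ + λ⁻¹) u (m+1) + u m = 0`. -/
theorem streak_solution (l : ℂ) (hl : l ≠ 0) (m : ℕ) :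
    l ^ (m + 2) - (l + l⁻¹) * l ^ (m + 1) + l ^ m = 0 := by
  field_simp
  ring

/-- The weighted roll recurrence `(n−1) w(n+1) − (λ+λ⁻¹) n w n + (n+1) w (n−1) = 0` (here with `n ↦ n+1`,
so that it reads `n · w (n+2) − (λ+λ⁻¹)(n+1) w (n+1) + (n+2) w n = 0`) is solved by
`w n = λ^n (n + b₀)`, `b₀ = (1 + λ²)/(1 − λ²)`. -/
theorem roll_weighted_solution (l : ℂ) (hl : l ≠ 0) (h1 : 1 - l ^ 2 ≠ 0) (n : ℕ) :
    let b₀ : ℂ := (1 + l ^ 2) / (1 - l ^ 2)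
    let w : ℕ → ℂ := fun k => l ^ k * ((k : ℂ) + b₀)
    (n : ℂ) * w (n + 2) - (l + l⁻¹) * ((n : ℂ) + 1) * w (n + 1) + ((n : ℂ) + 2) * w n = 0 := by
  intro b₀ w
  simp only [w, b₀]
  push_cast
  field_simp
  ring

/-- `D_s = −i ((u₁/u₀ − 1)/g − κ g/2)` with `u₁/u₀ = λ` and `κ = (λ + λ⁻¹ − 2)/g²` equals `−i (λ² − 1)/(2 g λ)`. -/
theorem Ds_closed_form (l g : ℂ) (hl : l ≠ 0) (hg : g ≠ 0) :
    -I * ((l - 1) / g - (l + l⁻¹ - 2) / g ^ 2 * g / 2) = -I * (l ^ 2 - 1) / (2 * g * l) := by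
  field_simp
  ring

/-- `D_r = (3i/8) v₁/v₂` with `v₁ = w 1 = λ (1 + b₀)` and `v₂ = w 2 / 2 = λ² (2 + b₀)/2` equals `(3i/2)/(λ (3 − λ²))`. -/
theorem Dr_closed_form (l : ℂ) (hl : l ≠ 0) (h1 : 1 - l ^ 2 ≠ 0) (h3 : 3 - l ^ 2 ≠ 0) :
    let b₀ : ℂ := (1 + l ^ 2) / (1 - l ^ 2)
    3 * I / 8 * (l * (1 + b₀)) / (l ^ 2 * (2 + b₀) / 2) = 3 * I / 2 / (l * (3 - l ^ 2)) := by
  intro b₀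
  simp only [b₀]
  have h2 : (2 : ℂ) + (1 + l ^ 2) / (1 - l ^ 2) = (3 - l ^ 2) / (1 - l ^ 2) := by
    field_simp; ring
  rw [h2]
  field_simp
  ring

/-- The geometric tail `Σ_{m ≥ 2} q^m = q²/(1 − q)` for `‖q‖ < 1`. -/
theorem hasSum_S0 (q : ℂ) (hq : ‖q‖ < 1) :
    HasSum (fun m : ℕ => q ^ (m + 2)) (q ^ 2 / (1 - q)) := by
  have h := hasSum_geometric_of_norm_lt_one hq
  have h' := h.mul_left (q ^ 2)
  have hF : (fun m : ℕ => q ^ (m + 2)) = fun i => q ^ 2 * q ^ i := by funext m; ring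
  rw [hF, div_eq_mul_inv]; exact h'

/-- The weighted tail `Σ_{m ≥ 2} m q^m = q² (2 − q)/(1 − q)²` for `‖q‖ < 1`. -/
theorem hasSum_S1 (q : ℂ) (hq : ‖q‖ < 1) :
    HasSum (fun m : ℕ => ((m : ℂ) + 2) * q ^ (m + 2)) (q ^ 2 * (2 - q) / (1 - q) ^ 2) := by
  have hq1 : (1 : ℂ) - q ≠ 0 := by
    intro h
    have : q = 1 := by linear_combination -h
    simp [this] at hq
  -- Σ m q^m = q/(1-q)^2 and Σ q^m = 1/(1-q), shifted by two
  have hA := hasSum_coe_mul_geometric_of_norm_lt_one hq      -- Σ m q^m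
  have hB := hasSum_geometric_of_norm_lt_one hq              -- Σ q^m
  -- Σ_{m} (m+2) q^{m+2} = q^2 ( Σ m q^m + 2 Σ q^m )
  have hC := (hA.add (hB.mul_left 2)).mul_left (q ^ 2)
  have hF : (fun m : ℕ => ((m : ℂ) + 2) * q ^ (m + 2)) = fun i : ℕ => q ^ 2 * ((i : ℂ) * q ^ i + 2 * q ^ i) := by
    funext m; ring
  have hV : q ^ 2 * (2 - q) / (1 - q) ^ 2 = q ^ 2 * (q / (1 - q) ^ 2 + 2 * (1 - q)⁻¹) := by
    field_simp; ring
  rw [hF, hV]; exact hC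

/-- The pairing sum in closed form: with `b₀ = (1+q)/(1−q)`, `S₀ = q²/(1−q)`, `S₁ = q²(2−q)/(1−q)²`,
`Ŝ = g (S₁ + b₀ S₀)/(q (2 + b₀)) = 3 g q/((1 − q)(3 − q))`. -/
theorem pairing_sum_closed_form (q g : ℂ) (hq : q ≠ 0) (h1 : 1 - q ≠ 0) (h3 : 3 - q ≠ 0) :
    g * (q ^ 2 * (2 - q) / (1 - q) ^ 2 + (1 + q) / (1 - q) * (q ^ 2 / (1 - q))) / (q * (2 + (1 + q) / (1 - q)))
      = 3 * g * q / ((1 - q) * (3 - q)) := by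
  have h2b : (2 : ℂ) + (1 + q) / (1 - q) = (3 - q) / (1 - q) := by
    field_simp; ring
  rw [h2b]
  field_simp
  ring

/-- THE CLOSED FORM.  With `Ŝ = 3 g λ²/((1 − λ²)(3 − λ²))` (previous lemma, `q = λ²`), `κ = (λ − 1)²/(λ g²)`,
`D_s = −i (λ²−1)/(2 g λ)`, `D_r = (3i/2)/(λ (3 − λ²))`:  `D_s D_r − κ Ŝ = D_s D_r · (1 + 4 λ³/(1 + λ)²)`.
Its zeros inside the unit disc are `λ = 1` (excluded: `x = 0`) and the roots of `4λ³ + λ² + 2λ + 1`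
(`λ ≈ −0.432`, i.e. `x ≈ −2.37/sc`, below the physical range `x ≥ −1/sc`; and `λ ≈ 0.091 ± 0.755 i`, i.e.
`x ≈ (−0.88 ∓ 0.27 i)/sc`, far outside the strip `|Im x| ≤ 1/4`). -/
theorem dispersion_closed_form (l g : ℂ) (hl : l ≠ 0) (hg : g ≠ 0) (h1 : 1 - l ^ 2 ≠ 0)
    (h3 : 3 - l ^ 2 ≠ 0) (hp : 1 + l ≠ 0) :
    (-I * (l ^ 2 - 1) / (2 * g * l)) * (3 * I / 2 / (l * (3 - l ^ 2)))
        - ((l - 1) ^ 2 / (l * g ^ 2)) * (3 * g * l ^ 2 / ((1 - l ^ 2) * (3 - l ^ 2)))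
      = (-I * (l ^ 2 - 1) / (2 * g * l)) * (3 * I / 2 / (l * (3 - l ^ 2))) * (1 + 4 * l ^ 3 / (1 + l) ^ 2) := by
  have hm : (1 : ℂ) - l ≠ 0 := by
    intro h; apply h1
    have : l = 1 := by linear_combination -h
    simp [this]
  have hfac : (1 : ℂ) - l ^ 2 = (1 - l) * (1 + l) := by ring
  rw [hfac]
  field_simp
  ring_nf
  simp only [Complex.I_sq]
  ring

/-- The factor two ways: `1 + 4λ³/(1+λ)² = (4λ³ + λ² + 2λ + 1)/(1 + λ)²`. -/
theorem factor_numerator (l : ℂ) (hp : 1 + l ≠ 0) :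
    1 + 4 * l ^ 3 / (1 + l) ^ 2 = (4 * l ^ 3 + l ^ 2 + 2 * l + 1) / (1 + l) ^ 2 := by
  field_simp
  ring

/-- `κ` two ways: `(λ + λ⁻¹ − 2)/g² = (λ − 1)²/(λ g²)`. -/
theorem kappa_two_ways (l g : ℂ) (hl : l ≠ 0) (hg : g ≠ 0) :
    (l + l⁻¹ - 2) / g ^ 2 = (l - 1) ^ 2 / (l * g ^ 2) := by
  field_simp
  ring

/-- The margin polynomial: for `t = cos θ ∈ [0, 1]` one has
`(1+t)² |1 + e^{2iθ}/cos²(θ/2)|² − (2/3)(1+t)² = (24 t³ + 25 t² − 10 t + 1)/3 = (24 t³ + 25 (t − 1/5)²)/3 ≥ 0`;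
here the polynomial inequality. -/
theorem far_zone_margin_poly (t : ℝ) (ht : 0 ≤ t) : 0 ≤ 24 * t ^ 3 + 25 * t ^ 2 - 10 * t + 1 := by
  nlinarith [sq_nonneg (t - 1/5), pow_nonneg ht 3]

/-- The real-variable identity behind the margin: with `C = (1 + t)/2` (`= cos²(θ/2)`), `c₂ = 2t² − 1` (`= cos 2θ`),
`s₂² = 1 − c₂²` (`sin² 2θ`), the squared modulus `(1 + c₂/C)² + s₂²/C²` equals `1 + 2 c₂/C + 1/C²`, and
`(1+t)² (1 + 2c₂/C + 1/C²) − (2/3)(1+t)² = (24 t³ + 25 t² − 10 t + 1)/3`. -/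
theorem far_zone_margin_identity (t s₂ : ℝ) (ht : 1 + t ≠ 0) (hs : s₂ ^ 2 = 1 - (2 * t ^ 2 - 1) ^ 2) :
    let C : ℝ := (1 + t) / 2
    let c₂ : ℝ := 2 * t ^ 2 - 1
    (1 + t) ^ 2 * ((1 + c₂ / C) ^ 2 + s₂ ^ 2 / C ^ 2) - 2 / 3 * (1 + t) ^ 2
      = (24 * t ^ 3 + 25 * t ^ 2 - 10 * t + 1) / 3 := by
  intro C c₂
  simp only [C, c₂]
  field_simp
  rw [hs]
  ring

/-- Consequence: on the arc (`0 ≤ t = cos θ ≤ 1`) the squared modulus is at least `2/3`. -/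
theorem far_zone_margin (t s₂ : ℝ) (ht0 : 0 ≤ t) (hs : s₂ ^ 2 = 1 - (2 * t ^ 2 - 1) ^ 2) :
    let C : ℝ := (1 + t) / 2
    let c₂ : ℝ := 2 * t ^ 2 - 1
    2 / 3 ≤ (1 + c₂ / C) ^ 2 + s₂ ^ 2 / C ^ 2 := by
  intro C c₂
  have ht : (1 : ℝ) + t ≠ 0 := by positivity
  have hid := far_zone_margin_identity t s₂ ht hs
  have hpoly := far_zone_margin_poly t ht0
  have hpos : 0 < (1 + t) ^ 2 := by positivity
  simp only at hid
  -- (1+t)^2 * (M - 2/3) = poly/3 ≥ 0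
  have key : 0 ≤ (1 + t) ^ 2 * (((1 + c₂ / C) ^ 2 + s₂ ^ 2 / C ^ 2) - 2 / 3) := by
    have : (1 + t) ^ 2 * (((1 + c₂ / C) ^ 2 + s₂ ^ 2 / C ^ 2) - 2 / 3)
        = (1 + t) ^ 2 * ((1 + c₂ / C) ^ 2 + s₂ ^ 2 / C ^ 2) - 2 / 3 * (1 + t) ^ 2 := by ring
    rw [this, hid]
    positivity
  have hM : 0 ≤ ((1 + c₂ / C) ^ 2 + s₂ ^ 2 / C ^ 2) - 2 / 3 := (mul_nonneg_iff_of_pos_left hpos).mp key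
  linarith

end Summit.AnomalousDissipation.SoloBlind.FarZone
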